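import Mathlib
import Literature.MathematicalPhysics.StatisticalMechanics.LocalMatchingCompactness

/-!
# Stub `stub_symDiscontinuous` of line `purity_stacking` — crux `IsometryAtoms.MinimisingLawsCohesive`
# (stmt-AtomisticToContinuum-15777)

Helper file for the registered stub `stub_symDiscontinuous`. Lands at
`Summits/AtomisticToContinuum/Crystallization/Theorems/IsometryAtomsMinimisingLawsCohesiveSymDiscontinuous.lean`
with `--supports stmt-AtomisticToContinuum-15777`.

## Statement

Let `Y ⊆ ℝ³` be `δ`-separated (`δ > 0`) and non-coplanar (no nonzero `n` and constant `c` with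
`⟪y, n⟫ = c` for all `y ∈ Y`). Then for every radius `R` the set of Euclidean isometries `g`
with `g '' Y = Y` that move some point of the closed ball `‖x‖ ≤ R` into that ball is finite:
the symmetry group of `Y` acts discontinuously.

## Proof

1. Non-coplanarity gives `affineSpan ℝ Y = ⊤` (`SymDiscontinuous.affineSpan_eq_top`): otherwise
   the direction of the span is a proper submodule, its orthogonal complement contains a nonzero
   `n`, and `⟪y, n⟫ = ⟪p, n⟫` for a fixed `p ∈ Y` and all `y ∈ Y`.
2. `exists_affineIndependent` yields an affinely independent `t ⊆ Y` with the same (full) affine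
   span; it is finite (`finite_set_of_fin_dim_affineIndependent`).
3. An affine isometry is determined by its values on `t` (`AffineEquiv.ext_on`), so evaluation
   on `t` is injective on the set in question; for a symmetry `g` moving `x` (`‖x‖ ≤ R`) into the
   ball, `g p ∈ Y` and `‖g p‖ ≤ dist p x + ‖g x‖ ≤ ‖p‖ + 2R` for `p ∈ t`, so the image lies in a
   finite product of the finite sets `Y ∩ closedBall 0 (‖p‖ + R + R)`
   (`finite_of_forall_le_dist_of_subset_closedBall`).
-/

noncomputable section

namespace Summit.AtomisticToContinuum.Crystallization.Theorems.IsometryAtomsMinimisingLawsCohesive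

namespace SymDiscontinuous

open Literature.MathematicalPhysics.StatisticalMechanics

/-- A non-coplanar subset of `ℝ³` (no nonzero normal vector `n` with `⟪y, n⟫` constant on `Y`)
affinely spans the whole space. -/
theorem affineSpan_eq_top {Y : Set (EuclideanSpace ℝ (Fin 3))}
    (hY : ¬ ∃ n : EuclideanSpace ℝ (Fin 3), n ≠ 0 ∧ ∃ c : ℝ, ∀ y ∈ Y, inner ℝ y n = c) :
    affineSpan ℝ Y = ⊤ := by
  by_contra hne
  apply hY
  rcases Y.eq_empty_or_nonempty with hYe | ⟨p, hp⟩
  · refine ⟨EuclideanSpace.single 0 1, ?_, 0, fun y hy => ?_⟩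
    · intro h
      have h1 := congrArg (fun v : EuclideanSpace ℝ (Fin 3) => v 0) h
      simp at h1
    · rw [hYe] at hy
      exact absurd hy (Set.notMem_empty _)
  · have hdir : (affineSpan ℝ Y).direction ≠ ⊤ := by
      intro htop
      exact hne ((AffineSubspace.direction_eq_top_iff_of_nonempty
        ((affineSpan_nonempty (k := ℝ) (s := Y)).mpr ⟨p, hp⟩)).mp htop)
    have horth : (affineSpan ℝ Y).directionᗮ ≠ ⊥ := by
      rwa [Ne, Submodule.orthogonal_eq_bot_iff]
    obtain ⟨n, hn, hn0⟩ := (Submodule.ne_bot_iff _).mp horth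
    refine ⟨n, hn0, inner ℝ p n, fun y hy => ?_⟩
    have hmem : y -ᵥ p ∈ (affineSpan ℝ Y).direction :=
      AffineSubspace.vsub_mem_direction (mem_affineSpan ℝ hy) (mem_affineSpan ℝ hp)
    have h0 : inner ℝ (y - p) n = 0 := Submodule.inner_right_of_mem_orthogonal hmem hn
    rwa [inner_sub_left, sub_eq_zero] at h0

/-- For an affine isometry `g` and points `p`, `x`: `‖g p‖ ≤ ‖p‖ + ‖x‖ + ‖g x‖`. -/
theorem norm_map_le (g : EuclideanSpace ℝ (Fin 3) ≃ᵃⁱ[ℝ] EuclideanSpace ℝ (Fin 3))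
    (p x : EuclideanSpace ℝ (Fin 3)) : ‖g p‖ ≤ ‖p‖ + ‖x‖ + ‖g x‖ := by
  calc ‖g p‖ = ‖(g p - g x) + g x‖ := by rw [sub_add_cancel]
    _ ≤ ‖g p - g x‖ + ‖g x‖ := norm_add_le _ _
    _ = dist p x + ‖g x‖ := by rw [← dist_eq_norm, g.dist_map]
    _ ≤ ‖p‖ + ‖x‖ + ‖g x‖ := by
      gcongr
      exact dist_le_norm_add_norm _ _

end SymDiscontinuous

open SymDiscontinuous Literature.MathematicalPhysics.StatisticalMechanics in
/-- **Discontinuity of the symmetry group of a separated non-coplanar point set.**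
If `Y ⊆ ℝ³` is `δ`-separated (`δ > 0`) and non-coplanar (there is no nonzero `n` with `⟪y, n⟫`
constant on `Y`), then for every `R` only finitely many Euclidean isometries `g` with `g '' Y = Y`
move some point of the closed ball `‖x‖ ≤ R` into that ball.

Proof: `Y` contains a finite affinely independent set `t` spanning `ℝ³` (non-coplanarity); an
affine isometry is determined by its restriction to `t`, and a symmetry moving the ball `‖·‖ ≤ R`
into itself maps each `p ∈ t` into the finite set `Y ∩ closedBall 0 (‖p‖ + 2R)`. -/
theorem stub_symDiscontinuous :
    ∀ δ : ℝ, 0 < δ → ∀ Y : Set (EuclideanSpace ℝ (Fin 3)),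
      (∀ x ∈ Y, ∀ y ∈ Y, x ≠ y → δ ≤ dist x y) →
      (¬ ∃ n : EuclideanSpace ℝ (Fin 3), n ≠ 0 ∧ ∃ c : ℝ, ∀ y ∈ Y, inner ℝ y n = c) →
      ∀ R : ℝ, {g : EuclideanSpace ℝ (Fin 3) ≃ᵃⁱ[ℝ] EuclideanSpace ℝ (Fin 3) |
        g '' Y = Y ∧ ∃ x : EuclideanSpace ℝ (Fin 3), ‖x‖ ≤ R ∧ ‖g x‖ ≤ R}.Finite := by
  intro δ hδ Y hsep hY R
  classical
  obtain ⟨t, htY, htspan, htind⟩ := exists_affineIndependent ℝ (EuclideanSpace ℝ (Fin 3)) Y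
  rw [affineSpan_eq_top hY] at htspan
  have htfin : t.Finite := finite_set_of_fin_dim_affineIndependent ℝ htind
  haveI : Finite t := htfin.to_subtype
  -- evaluation of an isometry on the affine frame `t`
  let Φ : (EuclideanSpace ℝ (Fin 3) ≃ᵃⁱ[ℝ] EuclideanSpace ℝ (Fin 3)) →
      (t → EuclideanSpace ℝ (Fin 3)) := fun g p => g p
  have hinj : Set.InjOn Φ {g : EuclideanSpace ℝ (Fin 3) ≃ᵃⁱ[ℝ] EuclideanSpace ℝ (Fin 3) |
      g '' Y = Y ∧ ∃ x : EuclideanSpace ℝ (Fin 3), ‖x‖ ≤ R ∧ ‖g x‖ ≤ R} := by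
    intro g₁ _ g₂ _ h
    apply AffineIsometryEquiv.toAffineEquiv_injective
    refine AffineEquiv.ext_on htspan _ _ (fun p hp => ?_)
    have h1 := congr_fun h ⟨p, hp⟩
    simpa [Φ] using h1
  have himg : Φ '' {g : EuclideanSpace ℝ (Fin 3) ≃ᵃⁱ[ℝ] EuclideanSpace ℝ (Fin 3) |
      g '' Y = Y ∧ ∃ x : EuclideanSpace ℝ (Fin 3), ‖x‖ ≤ R ∧ ‖g x‖ ≤ R} ⊆
      {f : t → EuclideanSpace ℝ (Fin 3) | ∀ p : t, f p ∈
        Y ∩ Metric.closedBall 0 (‖(p : EuclideanSpace ℝ (Fin 3))‖ + R + R)} := by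
    rintro _ ⟨g, ⟨hgY, x, hx, hgx⟩, rfl⟩ p
    refine ⟨?_, ?_⟩
    · rw [← hgY]
      exact Set.mem_image_of_mem _ (htY p.2)
    · rw [mem_closedBall_zero_iff]
      calc ‖g p‖ ≤ ‖(p : EuclideanSpace ℝ (Fin 3))‖ + ‖x‖ + ‖g x‖ := norm_map_le g p x
        _ ≤ ‖(p : EuclideanSpace ℝ (Fin 3))‖ + R + R := by gcongr
  have hfin : {f : t → EuclideanSpace ℝ (Fin 3) | ∀ p : t, f p ∈
      Y ∩ Metric.closedBall 0 (‖(p : EuclideanSpace ℝ (Fin 3))‖ + R + R)}.Finite :=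
    Set.Finite.pi' fun p => finite_of_forall_le_dist_of_subset_closedBall hδ
      (fun a ha b hb hab => hsep a ha.1 b hb.1 hab) Set.inter_subset_right
  exact Set.Finite.of_finite_image (hfin.subset himg) hinj

end Summit.AtomisticToContinuum.Crystallization.Theorems.IsometryAtomsMinimisingLawsCohesive

end
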